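import Mathlib.Analysis.Calculus.FDeriv.Bilinear
import Mathlib.Analysis.Calculus.ContDiff.Bounds
import Literature.Analysis.FunctionSpaces.ContDiffHolderAlgebra
import HarnessLib

/-!
# Leibniz estimates in the `C^{k,r}` norms: bilinear maps, linear maps, derivatives

Analysis/FunctionSpaces support file (everything proved). For the accepted extended norms
`eContDiffHolderNorm k r f = ∑_{j ≤ k} ‖Dʲf‖_∞ + [Dᵏf]_r` on a real normed space and
`Torus.eContDiffHolderNorm k r g` on the flat torus (`HolderNorm.lean`; Gilbarg–Trudinger §4.1
(4.4)), this file provides the three rules by which Buckmaster–De Lellis–Székelyhidi–Vicol 2019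
(App. A and §§3–4) manipulate Hölder norms of products and derivatives:

* `eContDiffHolderNorm_succ_eq_fderiv`: **derivative shift** `‖f‖_{k+1,r} = ‖f‖_∞ + ‖Df‖_{k,r}`
  (exact; `iteratedFDeriv_succ_eq_comp_right` is composition with a linear isometry), whence
  `‖Df‖_{k,r} ≤ ‖f‖_{k+1,r}` and, on the torus, `‖∂ᵢg‖_{k,r} ≤ ‖g‖_{k+1,r}`;
* `eContDiffHolderNorm_clm_comp_le`: **post-composition** `‖L ∘ f‖_{k,r} ≤ ‖L‖ ‖f‖_{k,r}` for a
  continuous linear `L`;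
* `eContDiffHolderNorm_bilinear_le`: the **Leibniz estimate** for a continuous bilinear map `B`,
  `‖B(f,g)‖_{k,r} ≤ 3ᵏ ‖B‖ ∑_{j ≤ k} ‖f‖_{j,r} ‖g‖_{k-j,r}` (BDSV App. A (A.2),
  `[fg]_s ≤ C([f]_s‖g‖₀ + ‖f‖₀[g]_s)`, in the non-interpolated form: by induction on `k` through
  `D(B(f,g)) = B(f,Dg) + B(Df,g)` (`ContinuousLinearMap.fderiv_of_bilinear`), the base case
  being `[B(f,g)]_r ≤ ‖B‖([f]_r‖g‖_∞ + ‖f‖_∞[g]_r)`);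
* torus versions of all three, and the convective derivative
  `‖(u·∇)v‖_{k,r} ≤ 3ᵏ ∑_{j ≤ k} ‖u‖_{j,r} ‖v‖_{k-j+1,r}` (`Torus.eContDiffHolderNorm_convect_le`).

As in Mathlib's `ContinuousLinearMap.norm_iteratedFDerivWithin_le_of_bilinear_aux`, the
induction over `k` replaces the value spaces by spaces of linear maps, so the Leibniz estimate is
stated for spaces in one universe (all consumers use `ℝ`, `ℝ³`, spaces of matrices).

## Mathlib / tree search

Mathlib (this pin): `ContinuousLinearMap.norm_iteratedFDerivWithin_le_of_bilinear` (sup norms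
only, pointwise), `ContinuousLinearMap.fderiv_of_bilinear`, `norm_precompR_le`,
`norm_precompL_le`, `iteratedFDeriv_succ_eq_comp_right`, `norm_iteratedFDeriv_fderiv`,
`ContinuousLinearMap.iteratedFDeriv_comp_left`, `ContinuousLinearMap.le_opENorm₂`
(`‖B a b‖ₑ ≤ ‖B‖ₑ ‖a‖ₑ ‖b‖ₑ`); no Hölder-seminorm Leibniz rule. Tree:
`ContDiffHolderAlgebra` (triangle inequality, homogeneity), `TorusHolderBridge`
(`eContDiffHolderNorm_zero_eq`, `eSupNorm_lift`, `lift_partialDeriv_eq`, the case `k = 0` of the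
product rule for scalar multiplication `eBoundedHolderNorm_smul_le`).

## References

* T. Buckmaster, C. De Lellis, L. Székelyhidi Jr., V. Vicol, *Onsager's conjecture for admissible
  weak solutions*, CPAM 72 (2019) = arXiv:1701.08678, App. A (A.1)–(A.3).
* D. Gilbarg, N. Trudinger, *Elliptic PDE of second order* (2001), §4.1 (4.4)–(4.7).
-/

open Set Filter
open scoped NNReal ENNReal ContDiff

noncomputable section

universe u

set_option maxSynthPendingDepth 3

namespace Literature.Analysis.FunctionSpaces

/-! ## Two facts on Hölder seminorms -/

section HolderElementary

variable {X Y Y' : Type*} [PseudoEMetricSpace Y] [PseudoEMetricSpace Y']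

/-- In a metric space the Hölder seminorm bounds every increment:
`d(f x, f y) ≤ [f]_r d(x,y)^r` (when `f` is not `r`-Hölder the right-hand side is `∞` for
`x ≠ y`). [folklore] -/
theorem edist_le_eHolderNorm_mul_rpow {Y : Type*} [MetricSpace X] [EMetricSpace Y] (r : ℝ≥0)
    (f : X → Y) (x y : X) :
    edist (f x) (f y) ≤ eHolderNorm r f * edist x y ^ (r : ℝ) := by
  by_cases hxy : x = y
  · subst hxy
    simp
  by_cases hf : MemHolder r f
  · rw [← hf.coe_nnHolderNorm_eq_eHolderNorm]
    exact hf.holderWith x y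
  · rw [eHolderNorm_eq_top.2 hf]
    have hpos : edist x y ^ (r : ℝ) ≠ 0 := by
      rw [Ne, ENNReal.rpow_eq_zero_iff, not_or]
      refine ⟨fun h => (edist_pos.2 hxy).ne' h.1, fun h => ?_⟩
      exact (not_lt.2 r.2 : ¬ ((r : ℝ) < 0)) h.2
    rw [ENNReal.top_mul hpos]
    exact le_top

/-- A pointwise Hölder bound with an extended constant bounds the Hölder seminorm. [folklore] -/
theorem eHolderNorm_le_of_forall_edist_le [PseudoEMetricSpace X] {K : ℝ≥0∞} {r : ℝ≥0}
    {f : X → Y} (h : ∀ x y, edist (f x) (f y) ≤ K * edist x y ^ (r : ℝ)) :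
    eHolderNorm r f ≤ K := by
  rcases eq_or_ne K ⊤ with rfl | hK
  · exact le_top
  have hH : HolderWith K.toNNReal r f := fun x y => by
    rw [ENNReal.coe_toNNReal hK]
    exact h x y
  exact hH.eHolderNorm_le.trans (ENNReal.coe_toNNReal hK).le

/-- The Hölder seminorm only depends on the increments. [folklore] -/
theorem eHolderNorm_congr_edist [PseudoEMetricSpace X] (r : ℝ≥0) {f : X → Y} {g : X → Y'}
    (h : ∀ x y, edist (g x) (g y) = edist (f x) (f y)) : eHolderNorm r g = eHolderNorm r f := by
  simp only [eHolderNorm, HolderWith, h]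

end HolderElementary

/-! ## Sup norm and Hölder seminorm of a bilinear expression -/

section BilinearZero

variable {X : Type*} {Y₁ Y₂ Z : Type*} [NormedAddCommGroup Y₁] [NormedSpace ℝ Y₁]
  [NormedAddCommGroup Y₂] [NormedSpace ℝ Y₂] [NormedAddCommGroup Z] [NormedSpace ℝ Z]

/-- `‖B(f,g)‖_∞ ≤ ‖B‖ ‖f‖_∞ ‖g‖_∞`. [folklore] -/
theorem eSupNorm_bilinear_le (B : Y₁ →L[ℝ] Y₂ →L[ℝ] Z) (f : X → Y₁) (g : X → Y₂) :
    eSupNorm (fun x => B (f x) (g x)) ≤ ‖B‖ₑ * eSupNorm f * eSupNorm g := by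
  refine iSup_le fun x => (B.le_opENorm₂ (f x) (g x)).trans ?_
  gcongr
  · exact enorm_le_eSupNorm f x
  · exact enorm_le_eSupNorm g x

/-- **Product rule for the Hölder seminorm** (BDSV (A.2) with `s = r ∈ [0,1]`, Gilbarg–Trudinger
(4.7)): `[B(f,g)]_r ≤ ‖B‖ ([f]_r ‖g‖_∞ + ‖f‖_∞ [g]_r)`. [folklore] -/
theorem eHolderNorm_bilinear_le [MetricSpace X] (B : Y₁ →L[ℝ] Y₂ →L[ℝ] Z) (r : ℝ≥0)
    (f : X → Y₁) (g : X → Y₂) :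
    eHolderNorm r (fun x => B (f x) (g x)) ≤
      ‖B‖ₑ * (eHolderNorm r f * eSupNorm g + eSupNorm f * eHolderNorm r g) := by
  refine eHolderNorm_le_of_forall_edist_le fun x y => ?_
  have hsplit : B (f x) (g x) - B (f y) (g y) = B (f x - f y) (g x) + B (f y) (g x - g y) := by
    simp only [map_sub, sub_apply]
    abel
  calc edist (B (f x) (g x)) (B (f y) (g y))
      = ‖B (f x - f y) (g x) + B (f y) (g x - g y)‖ₑ := by rw [edist_eq_enorm_sub, hsplit]
    _ ≤ ‖B (f x - f y) (g x)‖ₑ + ‖B (f y) (g x - g y)‖ₑ := enorm_add_le _ _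
    _ ≤ ‖B‖ₑ * ‖f x - f y‖ₑ * ‖g x‖ₑ + ‖B‖ₑ * ‖f y‖ₑ * ‖g x - g y‖ₑ :=
        add_le_add (B.le_opENorm₂ _ _) (B.le_opENorm₂ _ _)
    _ ≤ ‖B‖ₑ * (eHolderNorm r f * edist x y ^ (r : ℝ)) * eSupNorm g +
          ‖B‖ₑ * eSupNorm f * (eHolderNorm r g * edist x y ^ (r : ℝ)) := by
        gcongr
        · rw [← edist_eq_enorm_sub]
          exact edist_le_eHolderNorm_mul_rpow r f x y
        · exact enorm_le_eSupNorm g x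
        · exact enorm_le_eSupNorm f y
        · rw [← edist_eq_enorm_sub]
          exact edist_le_eHolderNorm_mul_rpow r g x y
    _ = ‖B‖ₑ * (eHolderNorm r f * eSupNorm g + eSupNorm f * eHolderNorm r g) *
          edist x y ^ (r : ℝ) := by ring

end BilinearZero

/-! ## The `C^{k,r}` norms: derivative shift, linear maps, Leibniz -/

section Euclidean

variable {E' Y Z : Type*} [NormedAddCommGroup E'] [NormedSpace ℝ E'] [NormedAddCommGroup Y]
  [NormedSpace ℝ Y] [NormedAddCommGroup Z] [NormedSpace ℝ Z]
variable {k : ℕ} {r : ℝ≥0} {f : E' → Y}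

/-- `‖f‖_∞ ≤ ‖f‖_{C^{k,r}}` for every `k`. [folklore] -/
theorem eSupNorm_le_eContDiffHolderNorm (k : ℕ) (r : ℝ≥0) (f : E' → Y) :
    eSupNorm f ≤ eContDiffHolderNorm k r f := by
  rw [← eSupNorm_iteratedFDeriv_zero]
  unfold eContDiffHolderNorm
  refine le_trans ?_ le_self_add
  exact Finset.single_le_sum (f := fun i => eSupNorm (iteratedFDeriv ℝ i f)) (fun _ _ => bot_le)
    (Finset.mem_range.2 (Nat.succ_pos k))

/-- **Derivative shift**: `‖f‖_{C^{k+1,r}} = ‖f‖_∞ + ‖Df‖_{C^{k,r}}` (the `(j+1)`-st derivative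
of `f` is the `j`-th derivative of `Df` composed with a linear isometry). [folklore] -/
theorem eContDiffHolderNorm_succ_eq_fderiv (k : ℕ) (r : ℝ≥0) (f : E' → Y) :
    eContDiffHolderNorm (k + 1) r f = eSupNorm f + eContDiffHolderNorm k r (fderiv ℝ f) := by
  have hsup : ∀ j : ℕ, eSupNorm (iteratedFDeriv ℝ (j + 1) f) =
      eSupNorm (iteratedFDeriv ℝ j (fderiv ℝ f)) := by
    intro j
    simp only [eSupNorm, ← ofReal_norm, norm_iteratedFDeriv_fderiv]
  have hhol : eHolderNorm r (iteratedFDeriv ℝ (k + 1) f) =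
      eHolderNorm r (iteratedFDeriv ℝ k (fderiv ℝ f)) := by
    refine eHolderNorm_congr_edist r fun x y => ?_
    rw [iteratedFDeriv_succ_eq_comp_right, iteratedFDeriv_succ_eq_comp_right]
    exact (LinearIsometryEquiv.isometry _).edist_eq _ _
  unfold eContDiffHolderNorm
  rw [Finset.sum_range_succ' _ (k + 1), eSupNorm_iteratedFDeriv_zero, hhol]
  simp_rw [hsup]
  ring

/-- `‖Df‖_{C^{k,r}} ≤ ‖f‖_{C^{k+1,r}}`. [folklore] -/
theorem eContDiffHolderNorm_fderiv_le (k : ℕ) (r : ℝ≥0) (f : E' → Y) :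
    eContDiffHolderNorm k r (fderiv ℝ f) ≤ eContDiffHolderNorm (k + 1) r f := by
  rw [eContDiffHolderNorm_succ_eq_fderiv]
  exact le_add_self

/-- **Post-composition with a continuous linear map**: `‖L ∘ f‖_{C^{k,r}} ≤ ‖L‖ ‖f‖_{C^{k,r}}`
for `C^k` maps (`Dʲ(L ∘ f) = L ∘ Dʲf`). [folklore] -/
theorem eContDiffHolderNorm_clm_comp_le (L : Y →L[ℝ] Z) (hf : ContDiff ℝ k f) (r : ℝ≥0) :
    eContDiffHolderNorm k r (fun x => L (f x)) ≤ ‖L‖ₑ * eContDiffHolderNorm k r f := by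
  have hD : ∀ j ≤ k, ∀ x, iteratedFDeriv ℝ j (fun x => L (f x)) x =
      L.compContinuousMultilinearMap (iteratedFDeriv ℝ j f x) := fun j hj x =>
    L.iteratedFDeriv_comp_left hf.contDiffAt (by exact_mod_cast hj)
  have hnorm : ∀ m : E' [×k]→L[ℝ] Y, ∀ j : ℕ, ∀ m' : E' [×j]→L[ℝ] Y,
      ‖L.compContinuousMultilinearMap m'‖ₑ ≤ ‖L‖ₑ * ‖m'‖ₑ := by
    intro _ j m'
    rw [← ofReal_norm, ← ofReal_norm, ← ofReal_norm, ← ENNReal.ofReal_mul (norm_nonneg _)]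
    exact ENNReal.ofReal_le_ofReal (L.norm_compContinuousMultilinearMap_le m')
  unfold eContDiffHolderNorm
  rw [mul_add, Finset.mul_sum]
  refine add_le_add (Finset.sum_le_sum fun j hj => ?_) ?_
  · have hjk : j ≤ k := by simpa [Finset.mem_range, Nat.lt_succ_iff] using hj
    refine iSup_le fun x => ?_
    rw [hD j hjk x]
    exact (hnorm 0 j _).trans (mul_le_mul' le_rfl (enorm_le_eSupNorm _ x))
  · refine eHolderNorm_le_of_forall_edist_le fun x y => ?_
    rw [hD k le_rfl x, hD k le_rfl y, edist_eq_enorm_sub]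
    have hsub : L.compContinuousMultilinearMap (iteratedFDeriv ℝ k f x) -
        L.compContinuousMultilinearMap (iteratedFDeriv ℝ k f y) =
        L.compContinuousMultilinearMap (iteratedFDeriv ℝ k f x - iteratedFDeriv ℝ k f y) := by
      ext v
      simp
    rw [hsub, mul_assoc]
    refine (hnorm 0 k _).trans (mul_le_mul' le_rfl ?_)
    rw [← edist_eq_enorm_sub]
    exact edist_le_eHolderNorm_mul_rpow r _ x y

end Euclidean

section Leibniz

variable {E' Y₁ Y₂ Z : Type u} [NormedAddCommGroup E'] [NormedSpace ℝ E']
  [NormedAddCommGroup Y₁] [NormedSpace ℝ Y₁] [NormedAddCommGroup Y₂] [NormedSpace ℝ Y₂]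
  [NormedAddCommGroup Z] [NormedSpace ℝ Z]

/-- The case `k = 0` of the Leibniz estimate: `‖B(f,g)‖_{C^{0,r}} ≤ ‖B‖ ‖f‖_{C^{0,r}} ‖g‖_{C^{0,r}}`.
[folklore] -/
theorem eContDiffHolderNorm_zero_bilinear_le (B : Y₁ →L[ℝ] Y₂ →L[ℝ] Z) (r : ℝ≥0) (f : E' → Y₁)
    (g : E' → Y₂) :
    eContDiffHolderNorm 0 r (fun x => B (f x) (g x)) ≤
      ‖B‖ₑ * eContDiffHolderNorm 0 r f * eContDiffHolderNorm 0 r g := by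
  rw [eContDiffHolderNorm_zero_eq, eContDiffHolderNorm_zero_eq, eContDiffHolderNorm_zero_eq]
  calc eSupNorm (fun x => B (f x) (g x)) + eHolderNorm r (fun x => B (f x) (g x))
      ≤ ‖B‖ₑ * eSupNorm f * eSupNorm g +
          ‖B‖ₑ * (eHolderNorm r f * eSupNorm g + eSupNorm f * eHolderNorm r g) :=
        add_le_add (eSupNorm_bilinear_le B f g) (eHolderNorm_bilinear_le B r f g)
    _ = ‖B‖ₑ * (eSupNorm f * eSupNorm g + eHolderNorm r f * eSupNorm g +
          eSupNorm f * eHolderNorm r g) := by ring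
    _ ≤ ‖B‖ₑ * (eSupNorm f * eSupNorm g + eHolderNorm r f * eSupNorm g +
          eSupNorm f * eHolderNorm r g + eHolderNorm r f * eHolderNorm r g) :=
        mul_le_mul' le_rfl le_self_add
    _ = ‖B‖ₑ * (eSupNorm f + eHolderNorm r f) * (eSupNorm g + eHolderNorm r g) := by ring

/-- **Leibniz estimate in `C^{k,r}`** (BDSV App. A (A.2), non-interpolated form): for a continuous
bilinear map `B` and `C^k` maps `f`, `g`,
`‖B(f,g)‖_{C^{k,r}} ≤ 3ᵏ ‖B‖ ∑_{j ≤ k} ‖f‖_{C^{j,r}} ‖g‖_{C^{k-j,r}}`. Proof by induction on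
`k`: `‖h‖_{k+1,r} = ‖h‖_∞ + ‖Dh‖_{k,r}` and `D(B(f,g)) = B(f, Dg) + B(Df, g)` with bilinear maps
of norm `≤ ‖B‖` (`precompR`, `precompL`). [folklore] -/
theorem eContDiffHolderNorm_bilinear_le (B : Y₁ →L[ℝ] Y₂ →L[ℝ] Z) {f : E' → Y₁} {g : E' → Y₂}
    {k : ℕ} (hf : ContDiff ℝ k f) (hg : ContDiff ℝ k g) (r : ℝ≥0) :
    eContDiffHolderNorm k r (fun x => B (f x) (g x)) ≤
      3 ^ k * ‖B‖ₑ * ∑ j ∈ Finset.range (k + 1),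
        eContDiffHolderNorm j r f * eContDiffHolderNorm (k - j) r g := by
  induction k generalizing Y₁ Y₂ Z with
  | zero =>
    simpa [mul_assoc] using eContDiffHolderNorm_zero_bilinear_le B r f g
  | succ k IH =>
    -- notation
    set S : ℝ≥0∞ := ∑ j ∈ Finset.range (k + 1 + 1),
      eContDiffHolderNorm j r f * eContDiffHolderNorm (k + 1 - j) r g with hS
    have hf' : ContDiff ℝ k f := hf.of_le (by exact_mod_cast Nat.le_succ k)
    have hg' : ContDiff ℝ k g := hg.of_le (by exact_mod_cast Nat.le_succ k)
    have hDf : ContDiff ℝ k (fderiv ℝ f) := hf.fderiv_right (by exact_mod_cast le_rfl)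
    have hDg : ContDiff ℝ k (fderiv ℝ g) := hg.fderiv_right (by exact_mod_cast le_rfl)
    -- the derivative of `B(f,g)`
    have hderiv : fderiv ℝ (fun x => B (f x) (g x)) =
        (fun x => B.precompR E' (f x) (fderiv ℝ g x)) + fun x => B.precompL E' (fderiv ℝ f x) (g x) := by
      funext x
      exact B.fderiv_of_bilinear ((hf.differentiable (by simp)) x) ((hg.differentiable (by simp)) x)
    have hP : ContDiff ℝ k (fun x => B.precompR E' (f x) (fderiv ℝ g x)) :=
      (B.precompR E').isBoundedBilinearMap.contDiff.comp₂ hf' hDg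
    have hQ : ContDiff ℝ k (fun x => B.precompL E' (fderiv ℝ f x) (g x)) :=
      (B.precompL E').isBoundedBilinearMap.contDiff.comp₂ hDf hg'
    -- the three partial bounds against `S`
    have h1 : ∑ j ∈ Finset.range (k + 1), eContDiffHolderNorm j r f *
        eContDiffHolderNorm (k - j) r (fderiv ℝ g) ≤ S := by
      rw [hS, Finset.sum_range_succ (fun j => eContDiffHolderNorm j r f *
        eContDiffHolderNorm (k + 1 - j) r g) (k + 1)]
      refine le_trans (Finset.sum_le_sum fun j hj => ?_) le_self_add
      have hjk : j ≤ k := by simpa [Finset.mem_range, Nat.lt_succ_iff] using hj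
      have : k + 1 - j = (k - j) + 1 := by omega
      rw [this]
      exact mul_le_mul' le_rfl (eContDiffHolderNorm_fderiv_le (k - j) r g)
    have h2 : ∑ j ∈ Finset.range (k + 1), eContDiffHolderNorm j r (fderiv ℝ f) *
        eContDiffHolderNorm (k - j) r g ≤ S := by
      rw [hS, Finset.sum_range_succ' (fun j => eContDiffHolderNorm j r f *
        eContDiffHolderNorm (k + 1 - j) r g) (k + 1)]
      refine le_trans (Finset.sum_le_sum fun j hj => ?_) le_self_add
      have : k + 1 - (j + 1) = k - j := by omega
      rw [this]
      exact mul_le_mul' (eContDiffHolderNorm_fderiv_le j r f) le_rfl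
    have h3 : eSupNorm f * eSupNorm g ≤ S := by
      rw [hS, Finset.sum_range_succ' (fun j => eContDiffHolderNorm j r f *
        eContDiffHolderNorm (k + 1 - j) r g) (k + 1)]
      refine le_trans ?_ le_add_self
      rw [Nat.sub_zero]
      exact mul_le_mul (eSupNorm_le_eContDiffHolderNorm 0 r f)
        (eSupNorm_le_eContDiffHolderNorm (k + 1) r g) bot_le bot_le
    -- norms of the auxiliary bilinear maps
    have hBR : ‖B.precompR E'‖ₑ ≤ ‖B‖ₑ := by
      rw [← ofReal_norm, ← ofReal_norm]
      exact ENNReal.ofReal_le_ofReal (B.norm_precompR_le E')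
    have hBL : ‖B.precompL E'‖ₑ ≤ ‖B‖ₑ := by
      rw [← ofReal_norm, ← ofReal_norm]
      exact ENNReal.ofReal_le_ofReal (B.norm_precompL_le E')
    -- assemble
    calc eContDiffHolderNorm (k + 1) r (fun x => B (f x) (g x))
        = eSupNorm (fun x => B (f x) (g x)) +
            eContDiffHolderNorm k r ((fun x => B.precompR E' (f x) (fderiv ℝ g x)) +
              fun x => B.precompL E' (fderiv ℝ f x) (g x)) := by
          rw [eContDiffHolderNorm_succ_eq_fderiv, hderiv]
      _ ≤ ‖B‖ₑ * eSupNorm f * eSupNorm g +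
            (eContDiffHolderNorm k r (fun x => B.precompR E' (f x) (fderiv ℝ g x)) +
              eContDiffHolderNorm k r (fun x => B.precompL E' (fderiv ℝ f x) (g x))) :=
          add_le_add (eSupNorm_bilinear_le B f g) (eContDiffHolderNorm_add_le hP hQ)
      _ ≤ ‖B‖ₑ * S + (3 ^ k * ‖B‖ₑ * S + 3 ^ k * ‖B‖ₑ * S) := by
          refine add_le_add ?_ (add_le_add ?_ ?_)
          · rw [mul_assoc]
            exact mul_le_mul' le_rfl h3
          · refine (IH (B.precompR E') hf' hDg).trans ?_
            exact mul_le_mul' (mul_le_mul' le_rfl hBR) h1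
          · refine (IH (B.precompL E') hDf hg').trans ?_
            exact mul_le_mul' (mul_le_mul' le_rfl hBL) h2
      _ = (1 + 2 * 3 ^ k) * ‖B‖ₑ * S := by ring
      _ ≤ 3 ^ (k + 1) * ‖B‖ₑ * S := by
          gcongr
          rw [pow_succ]
          have h13 : (1 : ℝ≥0∞) ≤ 3 ^ k := one_le_pow₀ (by norm_num)
          calc (1 : ℝ≥0∞) + 2 * 3 ^ k ≤ 3 ^ k + 2 * 3 ^ k := add_le_add h13 le_rfl
            _ = 3 ^ k * 3 := by ring

end Leibniz

/-! ## The torus versions -/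

namespace Torus

section General

variable {d : Type*} [Fintype d] {Y Z : Type*} [NormedAddCommGroup Y] [NormedSpace ℝ Y]
  [NormedAddCommGroup Z] [NormedSpace ℝ Z]
variable {k : ℕ} {r : ℝ≥0} {g : UnitAddTorus d → Y}

/-- The lift of the torus derivative is the derivative of the lift (`Torus.fderiv_lift`). [folklore] -/
theorem lift_fderiv_eq (g : UnitAddTorus d → Y) : lift (Torus.fderiv g) = _root_.fderiv ℝ (lift g) :=
  funext fun y => (fderiv_lift g y).symm

/-- `‖g‖_∞ ≤ ‖g‖_{C^{k,r}(T^d)}` for every `k`. [folklore] -/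
theorem eSupNorm_le_eContDiffHolderNorm (k : ℕ) (r : ℝ≥0) (g : UnitAddTorus d → Y) :
    eSupNorm g ≤ Torus.eContDiffHolderNorm k r g := by
  rw [← eSupNorm_lift]
  exact FunctionSpaces.eSupNorm_le_eContDiffHolderNorm k r (lift g)

/-- **Derivative shift on the torus**: `‖g‖_{C^{k+1,r}} = ‖g‖_∞ + ‖Dg‖_{C^{k,r}}` with the torus
derivative `Torus.fderiv g : T^d → (ℝ^d →L Y)`. [folklore] -/
theorem eContDiffHolderNorm_succ_eq_fderiv (k : ℕ) (r : ℝ≥0) (g : UnitAddTorus d → Y) :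
    Torus.eContDiffHolderNorm (k + 1) r g =
      eSupNorm g + Torus.eContDiffHolderNorm k r (Torus.fderiv g) := by
  unfold Torus.eContDiffHolderNorm
  rw [lift_fderiv_eq, ← eSupNorm_lift]
  exact FunctionSpaces.eContDiffHolderNorm_succ_eq_fderiv k r (lift g)

/-- `‖Dg‖_{C^{k,r}} ≤ ‖g‖_{C^{k+1,r}}` on the torus. [folklore] -/
theorem eContDiffHolderNorm_fderiv_le (k : ℕ) (r : ℝ≥0) (g : UnitAddTorus d → Y) :
    Torus.eContDiffHolderNorm k r (Torus.fderiv g) ≤ Torus.eContDiffHolderNorm (k + 1) r g := by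
  rw [eContDiffHolderNorm_succ_eq_fderiv]
  exact le_add_self

/-- The torus derivative of a `C^{k+1}` map is `C^k`. [folklore] -/
theorem IsContDiff.torusFderiv_of_succ (hg : IsContDiff (k + 1 : ℕ) g) :
    IsContDiff k (Torus.fderiv g) := by
  unfold IsContDiff
  rw [lift_fderiv_eq]
  exact hg.fderiv_right (by exact_mod_cast le_rfl)

/-- The torus derivative of a smooth map is `C^k` for every `k`. [folklore] -/
theorem IsSmooth.isContDiff_torusFderiv (hg : IsSmooth g) (k : ℕ) : IsContDiff k (Torus.fderiv g) :=
  (hg.isContDiff (n := (k + 1 : ℕ)) (by exact_mod_cast le_top)).torusFderiv_of_succ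

/-- Post-composition with a continuous linear map on the torus:
`‖L ∘ g‖_{C^{k,r}} ≤ ‖L‖ ‖g‖_{C^{k,r}}`. [folklore] -/
theorem eContDiffHolderNorm_clm_comp_le (L : Y →L[ℝ] Z) (hg : IsContDiff k g) (r : ℝ≥0) :
    Torus.eContDiffHolderNorm k r (fun x => L (g x)) ≤ ‖L‖ₑ * Torus.eContDiffHolderNorm k r g :=
  FunctionSpaces.eContDiffHolderNorm_clm_comp_le L hg r

variable [DecidableEq d]

/-- **Partial derivatives**: `‖∂ᵢg‖_{C^{k,r}} ≤ ‖g‖_{C^{k+1,r}}` for `C^{k+1}` functions on the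
torus (`∂ᵢg = Dg · eᵢ` and `‖eᵢ‖ = 1`). [folklore] -/
theorem eContDiffHolderNorm_partialDeriv_le (hg : IsContDiff (k + 1 : ℕ) g) (i : d) (r : ℝ≥0) :
    Torus.eContDiffHolderNorm k r (partialDeriv i g) ≤ Torus.eContDiffHolderNorm (k + 1) r g := by
  have h1 : IsContDiff 1 g := hg.of_le (by exact_mod_cast Nat.le_add_left 1 k)
  have hlift : lift (partialDeriv i g) = fun a =>
      (ContinuousLinearMap.apply ℝ Y (EuclideanSpace.single i (1 : ℝ))) (_root_.fderiv ℝ (lift g) a) := by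
    rw [lift_partialDeriv_eq h1]
    rfl
  have hD : ContDiff ℝ k (_root_.fderiv ℝ (lift g)) := hg.fderiv_right (by exact_mod_cast le_rfl)
  have hnorm : ‖ContinuousLinearMap.apply ℝ Y (EuclideanSpace.single i (1 : ℝ))‖ₑ ≤ 1 := by
    rw [← ofReal_norm, ← ENNReal.ofReal_one]
    refine ENNReal.ofReal_le_ofReal (ContinuousLinearMap.opNorm_le_bound _ zero_le_one fun m => ?_)
    rw [ContinuousLinearMap.apply_apply, one_mul]
    simpa using m.le_opNorm (EuclideanSpace.single i (1 : ℝ))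
  calc Torus.eContDiffHolderNorm k r (partialDeriv i g)
      = FunctionSpaces.eContDiffHolderNorm k r (fun a =>
          (ContinuousLinearMap.apply ℝ Y (EuclideanSpace.single i (1 : ℝ)))
            (_root_.fderiv ℝ (lift g) a)) := by
        rw [Torus.eContDiffHolderNorm, hlift]
    _ ≤ ‖ContinuousLinearMap.apply ℝ Y (EuclideanSpace.single i (1 : ℝ))‖ₑ *
          FunctionSpaces.eContDiffHolderNorm k r (_root_.fderiv ℝ (lift g)) :=
        FunctionSpaces.eContDiffHolderNorm_clm_comp_le _ hD r
    _ ≤ 1 * FunctionSpaces.eContDiffHolderNorm k r (_root_.fderiv ℝ (lift g)) :=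
        mul_le_mul' hnorm le_rfl
    _ ≤ Torus.eContDiffHolderNorm (k + 1) r g := by
        rw [one_mul, ← lift_fderiv_eq]
        exact eContDiffHolderNorm_fderiv_le k r g

end General

section Leibniz

variable {d : Type u} [Fintype d] {Y₁ Y₂ Z : Type u} [NormedAddCommGroup Y₁] [NormedSpace ℝ Y₁]
  [NormedAddCommGroup Y₂] [NormedSpace ℝ Y₂] [NormedAddCommGroup Z] [NormedSpace ℝ Z]
variable {k : ℕ}

/-- **Leibniz estimate on the torus**: `‖B(f,g)‖_{C^{k,r}} ≤ 3ᵏ ‖B‖ ∑_{j ≤ k} ‖f‖_{j,r} ‖g‖_{k-j,r}`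
for `C^k` maps `f, g` on `T^d` and a continuous bilinear `B`. [folklore] -/
theorem eContDiffHolderNorm_bilinear_le (B : Y₁ →L[ℝ] Y₂ →L[ℝ] Z) {f : UnitAddTorus d → Y₁}
    {g : UnitAddTorus d → Y₂} (hf : IsContDiff k f) (hg : IsContDiff k g) (r : ℝ≥0) :
    Torus.eContDiffHolderNorm k r (fun x => B (f x) (g x)) ≤
      3 ^ k * ‖B‖ₑ * ∑ j ∈ Finset.range (k + 1),
        Torus.eContDiffHolderNorm j r f * Torus.eContDiffHolderNorm (k - j) r g :=
  FunctionSpaces.eContDiffHolderNorm_bilinear_le B hf hg r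

/-- The evaluation pairing `(u, M) ↦ M u` on `ℝ^d × (ℝ^d →L Y)` has norm at most `1`. [folklore] -/
theorem enorm_apply_le_one (Y : Type u) [NormedAddCommGroup Y] [NormedSpace ℝ Y] :
    ‖(ContinuousLinearMap.apply ℝ Y : EuclideanSpace ℝ d →L[ℝ] (EuclideanSpace ℝ d →L[ℝ] Y) →L[ℝ] Y)‖ₑ
      ≤ 1 := by
  rw [← ofReal_norm, ← ENNReal.ofReal_one]
  refine ENNReal.ofReal_le_ofReal
    (ContinuousLinearMap.opNorm_le_bound _ zero_le_one fun v => ?_)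
  rw [one_mul]
  refine ContinuousLinearMap.opNorm_le_bound _ (norm_nonneg v) fun m => ?_
  rw [ContinuousLinearMap.apply_apply, mul_comm]
  exact m.le_opNorm v

/-- **The convective derivative in `C^{k,r}`**: for `C^k` `u` and `C^{k+1}` `v` on `T^d`,
`‖(u·∇)v‖_{C^{k,r}} ≤ 3ᵏ ∑_{j ≤ k} ‖u‖_{C^{j,r}} ‖v‖_{C^{k-j+1,r}}` (Leibniz for the pairing
`(u, Dv) ↦ Dv·u`, then `‖Dv‖_{m,r} ≤ ‖v‖_{m+1,r}`). [folklore] -/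
theorem eContDiffHolderNorm_convect_le {u : UnitAddTorus d → EuclideanSpace ℝ d}
    {v : UnitAddTorus d → Y₁} (hu : IsContDiff k u) (hv : IsContDiff (k + 1 : ℕ) v) (r : ℝ≥0) :
    Torus.eContDiffHolderNorm k r (convect u v) ≤
      3 ^ k * ∑ j ∈ Finset.range (k + 1),
        Torus.eContDiffHolderNorm j r u * Torus.eContDiffHolderNorm (k - j + 1) r v := by
  have hDv : IsContDiff k (Torus.fderiv v) := hv.torusFderiv_of_succ
  have hconv : convect u v = fun x =>
      (ContinuousLinearMap.apply ℝ Y₁ : EuclideanSpace ℝ d →L[ℝ] (EuclideanSpace ℝ d →L[ℝ] Y₁) →L[ℝ] Y₁)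
        (u x) (Torus.fderiv v x) := by
    funext x
    rfl
  rw [hconv]
  refine (eContDiffHolderNorm_bilinear_le _ hu hDv r).trans ?_
  calc 3 ^ k * ‖(ContinuousLinearMap.apply ℝ Y₁ :
          EuclideanSpace ℝ d →L[ℝ] (EuclideanSpace ℝ d →L[ℝ] Y₁) →L[ℝ] Y₁)‖ₑ *
          ∑ j ∈ Finset.range (k + 1), Torus.eContDiffHolderNorm j r u *
            Torus.eContDiffHolderNorm (k - j) r (Torus.fderiv v)
      ≤ 3 ^ k * 1 * ∑ j ∈ Finset.range (k + 1), Torus.eContDiffHolderNorm j r u *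
            Torus.eContDiffHolderNorm (k - j + 1) r v := by
        gcongr with j hj
        · exact enorm_apply_le_one Y₁
        · exact eContDiffHolderNorm_fderiv_le _ r v
    _ = _ := by rw [mul_one]

end Leibniz

end Torus

end Literature.Analysis.FunctionSpaces
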